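import Summits.Ventures.PercRepro.C041BlockMapSeries

/-!
# ROW C-041 — THEOREM (REDUCTION TO CORES): CONJECTURE (BLOCK MAP) for every host follows from its truth on the
CORES — the hosts with no loop, no parallel edges, no vertex of degree `≤ 1` (the anchor included), no
non-terminal vertex of degree two and no cut vertex (p6, gen 37; §28 (a) of proofs/P6-TWOEXIT-LEAN.md in the kernel)

A host `Z` (unmarked) with exits `u` and anchor `a` is REDUCIBLE (`Reducible Z u a`) when it has a loop, two parallel
edges, a non-anchor vertex all of whose edges go to one other vertex (degree `≤ 1`), an anchor all of whose edges go
to one other vertex, a non-terminal vertex of degree exactly two (two non-loops, nothing else), or a nontrivial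
separation (THEOREM (CUT VERTEX): a cut vertex with edges on both sides).  A CORE is a host that is not reducible.
Each feature reduces `Z` to one or two hosts with fewer vertices or edges (`C041BlockMapLocalReductions`,
`C041BlockMapSeries`, `C041BlockMapCutVertex`).  **THEOREM (REDUCTION TO CORES)** (`coneHost_of_cores`): if every
core is a cone host (for its exits and anchor), every host is — by strong induction on the number of vertices and
edges.  READING: the open content of CONJECTURE (BLOCK MAP) is exactly its restriction to the cores — the
2-connected loopless simple hosts whose non-terminal vertices have degree `≥ 3` and whose terminal vertices have
degree `≥ 2`: on three vertices the triangle with two exits, on four `K₄` and the two diamonds `K₄ − uu′`,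
`K₄ − au` (THE FOUR-VERTEX CLASSIFICATION, `C041BlockMapHost4All`, is the case `|V| ≤ 4` of this theorem, by hand).
-/

namespace PercRepro

namespace ZoneZ

namespace MultiExit

open ZoneData Pendant Finset TwoExit TreeClosure

/-! ## Reducible hosts and cores -/

section Def

variable {V E ι : Type} (Z : ZoneData V E Empty Empty) [DecidableEq V] (u : ι → V) (a : V)

/-- A host with exits `u` and anchor `a` is REDUCIBLE when it has a loop, two parallel edges, a non-anchor vertex of
degree `≤ 1`, an anchor of degree `≤ 1`, a non-terminal vertex of degree two, or a nontrivial separation. -/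
def Reducible : Prop :=
  (∃ ℓ, Z.fst ℓ = Z.snd ℓ) ∨
  (∃ e e', e ≠ e' ∧ Z.Joins e' (Z.fst e) (Z.snd e)) ∨
  (∃ x p, x ≠ a ∧ x ≠ p ∧ ∀ e, Z.fst e = x ∨ Z.snd e = x → Z.Joins e p x) ∨
  (∃ x, x ≠ a ∧ ∀ e, Z.fst e = a ∨ Z.snd e = a → Z.Joins e a x) ∨
  (∃ x e₁ e₂, (∀ k, u k ≠ x) ∧ a ≠ x ∧ e₁ ≠ e₂ ∧ (Z.fst e₁ = x ∨ Z.snd e₁ = x) ∧ (Z.fst e₂ = x ∨ Z.snd e₂ = x) ∧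
    Z.fst e₁ ≠ Z.snd e₁ ∧ Z.fst e₂ ≠ Z.snd e₂ ∧ ∀ f, f ≠ e₁ → f ≠ e₂ → Z.fst f ≠ x ∧ Z.snd f ≠ x) ∨
  (∃ (A : V → Prop) (_ : DecidablePred A) (v : V), A v ∧ A a ∧ Sep Z A v ∧ (∃ e, InA Z A e) ∧ ∃ e, ¬ InA Z A e)

/-- A CORE: a host that is not reducible. -/
def IsCore : Prop := ¬ Reducible Z u a

end Def

/-- CONJECTURE (BLOCK MAP) FOR THE CORES: every core is a cone host. -/
def CoresConj : Prop :=
  ∀ {V E ι : Type} [Fintype V] [DecidableEq V] [Fintype E] [DecidableEq E] [Fintype ι] [DecidableEq ι]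
    (Z : ZoneData V E Empty Empty) (u : ι → V) (a : V), IsCore Z u a → ConeHost Z u a

/-! ## Counting -/

/-- A subtype missing an element is smaller. -/
theorem card_subtype_ne_lt {V : Type} [Fintype V] [DecidableEq V] (x : V) :
    Fintype.card {y // y ≠ x} < Fintype.card V :=
  Fintype.card_subtype_lt (x := x) fun h => h rfl

/-- The vertices of the far side of a separation at `{a, x}`, `a ≠ x`, are fewer than those of the host. -/
theorem card_option_subtype_pair_lt {V : Type} [Fintype V] [DecidableEq V] (a x : V) (hax : a ≠ x) :
    Fintype.card (Option {y // ¬ (y = a ∨ y = x)}) < Fintype.card V := by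
  let f : Option {y // ¬ (y = a ∨ y = x)} → V := fun o => o.elim a Subtype.val
  have hinj : Function.Injective f := by
    rintro (_ | ⟨y, hy⟩) (_ | ⟨y', hy'⟩) h
    · rfl
    · exact absurd h.symm fun h' => hy' (Or.inl h')
    · exact absurd h fun h' => hy (Or.inl h')
    · have h' : y = y' := h
      subst h'
      rfl
  have hx : x ∉ Set.range f := by
    rintro ⟨(_ | ⟨y, hy⟩), h⟩
    · exact hax h
    · exact hy (Or.inr h)
  exact Fintype.card_lt_of_injective_of_notMem f hinj hx

/-- The vertices of the far side of a separation (the anchor in `A`) are at most those of the host. -/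
theorem card_option_subtype_compl_le {V : Type} [Fintype V] [DecidableEq V] (A : V → Prop) [DecidablePred A]
    (a : V) (ha : A a) : Fintype.card (Option {y // ¬ A y}) ≤ Fintype.card V := by
  rw [Fintype.card_option]
  have := Fintype.card_subtype_lt (p := fun y => ¬ A y) (x := a) (fun h => h ha)
  omega

/-- The edges inside a separation with an edge outside are fewer. -/
theorem card_inA_lt {V E : Type} [Fintype E] [DecidableEq E] (Z : ZoneData V E Empty Empty) (A : V → Prop)
    [DecidablePred A] (e : E) (he : ¬ InA Z A e) : Fintype.card {e // InA Z A e} < Fintype.card E :=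
  Fintype.card_subtype_lt (x := e) he

/-- The edges outside a separation with an edge inside are fewer. -/
theorem card_notInA_lt {V E : Type} [Fintype E] [DecidableEq E] (Z : ZoneData V E Empty Empty) (A : V → Prop)
    [DecidablePred A] (e : E) (he : InA Z A e) : Fintype.card {e // ¬ InA Z A e} < Fintype.card E :=
  Fintype.card_subtype_lt (x := e) fun h => h he

/-! ## THEOREM (REDUCTION TO CORES) -/

/-- The induction: every host whose vertices and edges number at most `n` is a cone host, given the cores. -/
theorem coneHost_of_cores_card (hcore : CoresConj) : ∀ (n : ℕ) {V E ι : Type} [Fintype V] [DecidableEq V]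
    [Fintype E] [DecidableEq E] [Fintype ι] [DecidableEq ι] (Z : ZoneData V E Empty Empty) (u : ι → V) (a : V),
    Fintype.card V + Fintype.card E ≤ n → ConeHost Z u a := by
  intro n
  induction n with
  | zero =>
    intro V E ι _ _ _ _ _ _ Z u a hn
    -- no vertices: the anchor cannot exist
    have hV : Fintype.card V = 0 := by omega
    exact (Fintype.card_eq_zero_iff.1 hV).elim a
  | succ n ih =>
    intro V E ι _ _ _ _ _ _ Z u a hn
    by_cases hred : Reducible Z u a
    · rcases hred with ⟨ℓ, hℓ⟩ | ⟨e, e', hne, hpar⟩ | ⟨x, p, hxa, hxp, hx⟩ | ⟨x, hxa, hax⟩ |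
          ⟨x, e₁, e₂, hu, ha, hne, T₁, T₂, L₁, L₂, hx⟩ | ⟨A, _, v, hv, ha, hsep, ⟨e₀, he₀⟩, ⟨e₁, he₁⟩⟩
      · -- a loop
        refine coneHost_of_loop Z ℓ hℓ u a (ih (del Z ℓ) u a ?_)
        have := card_subtype_ne_lt ℓ
        omega
      · -- parallel edges
        refine coneHost_of_parallel Z e e' hne hpar u a (ih (del Z e') u a ?_) (ih _ _ _ ?_)
        · have := card_subtype_ne_lt e'
          omega
        · have := card_subtype_ne_lt e'
          omega
      · -- a non-anchor vertex of degree `≤ 1`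
        refine coneHost_of_degree_le_one Z x p a hxa hxp hx u (ih _ _ _ ?_)
        have h1 := card_subtype_ne_lt x
        have h2 := Fintype.card_subtype_le (InA Z fun y => y ≠ x)
        omega
      · -- the anchor of degree `≤ 1`
        refine coneHost_of_anchor_degree_le_one Z a x hax u (ih _ _ _ ?_)
        have h1 := card_option_subtype_pair_lt a x (Ne.symm hxa)
        have h2 := Fintype.card_subtype_le fun e => ¬ InA Z (fun y => y = a ∨ y = x) e
        omega
      · -- a non-terminal vertex of degree two
        refine coneHost_of_series Z x e₁ e₂ hx (other_ne Z x T₁ L₁) (other_ne Z x T₂ L₂) hne T₁ T₂ u a hu ha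
          (ih _ _ _ ?_) (ih _ _ _ ?_)
        · have h1 := card_subtype_ne_lt x
          have h2 := Fintype.card_subtype_le fun f => f ≠ e₂
          omega
        · have h1 := card_subtype_ne_lt x
          have h2 := Fintype.card_subtype_le fun f => f ≠ e₂
          have h3 := Fintype.card_subtype_le fun f : {f // f ≠ e₂} => f ≠ ⟨e₁, hne⟩
          omega
      · -- a nontrivial separation
        refine coneHost_of_sep Z A v hv a ha hsep u (ih _ _ _ ?_) (ih _ _ _ ?_)
        · have h1 := Fintype.card_subtype_le A
          have h2 := card_inA_lt Z A e₁ he₁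
          omega
        · have h1 := card_option_subtype_compl_le A a ha
          have h2 := card_notInA_lt Z A e₀ he₀
          omega
    · exact hcore Z u a hred

/-- **THEOREM (REDUCTION TO CORES)**: if every core is a cone host, every host is — CONJECTURE (BLOCK MAP) for all
hosts is its restriction to the cores. -/
theorem coneHost_of_cores (hcore : CoresConj) {V E ι : Type} [Fintype V] [DecidableEq V] [Fintype E] [DecidableEq E]
    [Fintype ι] [DecidableEq ι] (Z : ZoneData V E Empty Empty) (u : ι → V) (a : V) : ConeHost Z u a :=
  coneHost_of_cores_card hcore _ Z u a le_rfl

/-- CONJECTURE (BLOCK MAP) for every host, as one statement. -/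
def AllConj : Prop :=
  ∀ {V E ι : Type} [Fintype V] [DecidableEq V] [Fintype E] [DecidableEq E] [Fintype ι] [DecidableEq ι]
    (Z : ZoneData V E Empty Empty) (u : ι → V) (a : V), ConeHost Z u a

/-- **CONJECTURE (BLOCK MAP) for all hosts is equivalent to CONJECTURE (BLOCK MAP) for the cores.** -/
theorem allConj_iff_coresConj : AllConj ↔ CoresConj := by
  constructor
  · intro h V E ι _ _ _ _ _ _ Z u a _
    exact h Z u a
  · intro h V E ι _ _ _ _ _ _ Z u a
    exact coneHost_of_cores h Z u a

end MultiExit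

end ZoneZ

end PercRepro
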